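import Literature.AlgebraicGeometry.AbelianSchemes.PoincareSheafBiadditive
import Literature.AlgebraicGeometry.AbelianSchemes.AbelianSchemeOverHomNoetherianAnyBase
import Literature.AlgebraicGeometry.AbelianSchemes.RigidifiedLineBundleTensor
import Literature.AlgebraicGeometry.AbelianSchemes.ModuleSliceOfBaseChange
import HarnessLib

/-!
# The Poincaré sheaf is multiplicative in `Â` over ANY locally Noetherian base (no reducedness, no connectedness):
# `(1_A × g₁g₂)^*𝒫 ≅ (1_A × g₁)^*𝒫 ⊗ (1_A × g₂)^*𝒫`

Layer `Literature/AlgebraicGeometry/AbelianSchemes`, namespace `Literature.AlgebraicGeometry.AbelianSchemes.AbelianSchemeOver.DualPair`.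
THEOREMS ONLY (no definition, no named fact, no instance, no notation, no `sorry`).  Cell `hodgecm-mathlib` (D-0151), F-DAG row
F-2 (e)/(d) «any-base editions» (B-p17 (g12), byte (α) FILE 1): the third edition of the biadditivity of `𝒫` — ★
`PoincareSheafBiadditive` (REDUCED locally Noetherian base), ★ `PoincareSheafBiadditiveNoetherian` (CONNECTED locally Noetherian base)
— now over ANY locally Noetherian base.  The ONLY place connectedness entered the ★ connected edition is [MumfordFogartyKirwan1994]
Cor. 6.4 «an `S`-morphism of abelian schemes preserving the unit section is a homomorphism», used there through rigidity at ONE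
geometric point of a connected base (★ `isMonHom_of_one_comp_of_isLocallyNoetherian`); ★ `AbelianSchemeOverHomNoetherianAnyBase.
isMonHom_of_one_comp_of_isLocallyNoetherian_base` proves Cor. 6.4 over any locally Noetherian base (pointwise at ALL residue
fields + Stein), so the same proof runs verbatim.  Downstream, the 6.10/6.11 chain (★ `AbelianSchemeTheoremOfSquareOfDualPair`,
★ `AbelianSchemeLDelta*`) may thereby drop `PreconnectedSpace S` (the moduli base `H₄` of [MumfordFogartyKirwan1994] Prop. 7.3
is not connected).

* §1–§3 (private, `pullbackP` spelling, bodies verbatim from the ★ connected edition with the one rigidity lemma swapped): the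
  classifying morphism of `𝒫_{pr₁} ⊗ 𝒫_{pr₂}` IS the group law of `Â`; `(1_A × g₁g₂)^*𝒫 ≅ (1_A × g₁)^*𝒫 ⊗ (1_A × g₂)^*𝒫`;
  the inverse; the powers `(1_A × gⁿ)^*𝒫 ≅ ((1_A × g)^*𝒫)^{⊗n}`.
* §4 PUBLIC FORMS in the `Over S` spelling `(A ◁ g)^*𝒫 = (1_A × g)^*𝒫` (`pullbackP_eq_pullback_whiskerLeft`, ★
  `baseChangeToProd_eq_whiskerLeft_left`): **`nonempty_pullback_whiskerLeft_mul_iso_tensor`**,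
  **`nonempty_tensor_pullback_whiskerLeft_inv_iso_unit`**, **`nonempty_pullback_whiskerLeft_pow_iso_tensorPow`** — for every
  `T : Over S` and `g, g₁, g₂ : T ⟶ Â`, over ANY locally Noetherian `S` with `hD`.  (The statements are spelled with `A ◁ g`
  so that they do not shadow the ★ reduced-base and connected-base editions, which keep their `pullbackP` spelling and stronger
  hypotheses.)

HC_CM is proved only modulo the 7 printed citations until rung 0 closes; nothing here is about HC.

## References
* [MumfordAV1970] D. Mumford, *Abelian Varieties* (1970), §8 (pp. 74–75), §13 (p. 125).
* [MilneAV2008] J. S. Milne, *Abelian Varieties* (v2.00, 2008), I §8 pp. 36–37.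
* [MumfordFogartyKirwan1994] D. Mumford, J. Fogarty, F. Kirwan, *Geometric Invariant Theory*, 3rd ed. (1994), Ch. 6 §1
  Prop. 6.1 (p. 115), Cor. 6.4 (p. 117); Ch. 7 §3 Prop. 7.3 (pp. 133–134).
-/

set_option backward.isDefEq.respectTransparency false

noncomputable section

open CategoryTheory CategoryTheory.Limits AlgebraicGeometry MonoidalCategory CartesianMonoidalCategory
open scoped MonObj

universe u

namespace Literature.AlgebraicGeometry.AbelianSchemes

open Literature.AlgebraicGeometry.Motives Literature.AlgebraicGeometry.Modules

namespace AbelianSchemeOver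

variable {S : Scheme.{u}} {A : AbelianSchemeOver S}

namespace DualPair

variable (D : A.DualPair) [IsLocallyNoetherian S]

/-! ## §1 The classifying morphism of `𝒫_{pr₁} ⊗ 𝒫_{pr₂}` is the group law — any locally Noetherian base -/

/-- **THE CLASSIFYING MORPHISM OF `𝒫_{pr₁} ⊗ 𝒫_{pr₂}` IS THE GROUP LAW `pr₁ · pr₂ : Â ×_S Â → Â`** over ANY locally
Noetherian base (no reducedness, no connectedness), under the unit hypothesis `hD : 𝒫|_{A × {ε_Â}} ≅ 𝒪`:
`(1_A × pr₁pr₂)^*𝒫 ≅ (1_A × pr₁)^*𝒫 ⊗ (1_A × pr₂)^*𝒫` on `A_{Â ×_S Â}`.  Proof = ★ `nonempty_pullbackP_fst_mul_snd_iso_tensor`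
with [MumfordFogartyKirwan1994] Cor. 6.4 in its any-locally-Noetherian-base form (★ `isMonHom_of_one_comp_of_isLocallyNoetherian_base`,
all residue-field points instead of one geometric point of a connected base): the classifying `m′` kills the unit (by `hD`),
is therefore a homomorphism `Â ×_S Â → Â`, is the identity on the two axes, hence is `pr₁ · pr₂`.  Body adapted verbatim from ★
`PoincareSheafBiadditiveNoetherian` (B-p07 (g15)); private, the public form is §2.
[cite: MumfordAV1970, §8 (pp. 74–75) and §13 (p. 125)] [cite: MumfordFogartyKirwan1994, Ch. 6 §1 Corollary 6.4 (p. 117)] -/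
private theorem nonempty_pullbackP_fst_mul_snd_iso_tensor_of_isLocallyNoetherian_base
    (hD : Nonempty ((Scheme.Modules.pullback (unitHatSlice D)).obj D.P ≅ SheafOfModules.unit _)) :
    Nonempty (D.pullbackP (D.hat.X ⊗ D.hat.X).hom (fst D.hat.X D.hat.X * snd D.hat.X D.hat.X).left (Over.w _) ≅
      tensorObj (D.pullbackP (D.hat.X ⊗ D.hat.X).hom (fst D.hat.X D.hat.X).left (Over.w _))
        (D.pullbackP (D.hat.X ⊗ D.hat.X).hom (snd D.hat.X D.hat.X).left (Over.w _))) := by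
  obtain ⟨m, hm, hiso, huniq⟩ := D.exists_classify_tensor
  -- `𝒪 ⊗`-absorption of the unit coordinate: `(1_A × (f ≫ ε))^*𝒫 ≅ 𝒪`
  have hunit : ∀ {T : Scheme.{u}} (f : T ⟶ S) (g : T ⟶ D.hat.X.left) (hg : g ≫ D.hat.X.hom = f),
      g = f ≫ D.hat.unitSection → Nonempty (D.pullbackP f g hg ≅ SheafOfModules.unit _) := by
    intro T f g hg hgf
    have hf : (f ≫ D.hat.unitSection) ≫ D.hat.X.hom = f := by
      rw [Category.assoc, D.hat.unitSection_comp_hom, Category.comp_id]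
    rw [D.pullbackP_congr f hgf hg hf]
    exact D.nonempty_pullbackP_comp_unitSection_iso f hD hf
  -- (i) `m′` kills the unit
  have hone : (η[D.hat.X ⊗ D.hat.X]).left ≫ m = (η[D.hat.X]).left := by
    have hu : (η[D.hat.X ⊗ D.hat.X]).left ≫ (D.hat.X ⊗ D.hat.X).hom = 𝟙 S := Over.w _
    have key := huniq (η[D.hat.X ⊗ D.hat.X]).left
      ((η[D.hat.X ⊗ D.hat.X]).left ≫ (D.hat.X ⊗ D.hat.X).hom ≫ D.hat.unitSection)
      (by rw [Category.assoc, Category.assoc, D.hat.unitSection_comp_hom, Category.comp_id]) ?_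
    · rw [← key, ← Category.assoc, hu]; exact Category.id_comp _
    obtain ⟨e₀⟩ := hunit _ ((η[D.hat.X ⊗ D.hat.X]).left ≫ (D.hat.X ⊗ D.hat.X).hom ≫ D.hat.unitSection)
      (by rw [Category.assoc, Category.assoc, D.hat.unitSection_comp_hom, Category.comp_id]) rfl
    obtain ⟨e₁⟩ := hunit _ ((η[D.hat.X ⊗ D.hat.X]).left ≫ (fst D.hat.X D.hat.X).left)
      (by rw [Category.assoc, Over.w]) (by rw [← Over.comp_left, IsMonHom.one_hom, hu]; exact (Category.id_comp _).symm)
    obtain ⟨e₂⟩ := hunit _ ((η[D.hat.X ⊗ D.hat.X]).left ≫ (snd D.hat.X D.hat.X).left)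
      (by rw [Category.assoc, Over.w]) (by rw [← Over.comp_left, IsMonHom.one_hom, hu]; exact (Category.id_comp _).symm)
    exact ⟨e₀ ≪≫ (tensorUnitLeftIso _).symm ≪≫ (tensorMapIso e₁ e₂).symm⟩
  -- (iii) `m′` is the identity on the two axes
  have hinl : (lift (𝟙 D.hat.X) (toUnit _ ≫ η[D.hat.X])).left ≫ m = 𝟙 _ := by
    have hu : (lift (𝟙 D.hat.X) (toUnit _ ≫ η[D.hat.X])).left ≫ (D.hat.X ⊗ D.hat.X).hom = D.hat.X.hom := Over.w _
    have h1 : (lift (𝟙 D.hat.X) (toUnit _ ≫ η[D.hat.X])).left ≫ (fst D.hat.X D.hat.X).left = 𝟙 _ := by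
      rw [← Over.comp_left, lift_fst]; rfl
    have key := huniq (lift (𝟙 D.hat.X) (toUnit _ ≫ η[D.hat.X])).left
      ((lift (𝟙 D.hat.X) (toUnit _ ≫ η[D.hat.X])).left ≫ (fst D.hat.X D.hat.X).left) (by rw [Category.assoc, Over.w]) ?_
    · rw [← key, h1]
    obtain ⟨e₂⟩ := hunit _ ((lift (𝟙 D.hat.X) (toUnit _ ≫ η[D.hat.X])).left ≫ (snd D.hat.X D.hat.X).left)
      (by rw [Category.assoc, Over.w])
      (by rw [← Over.comp_left, lift_snd, Over.comp_left, Over.toUnit_left, hu])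
    exact ⟨(tensorUnitRightIso _).symm ≪≫ (tensorMapIso (Iso.refl _) e₂).symm⟩
  have hinr : (lift (toUnit _ ≫ η[D.hat.X]) (𝟙 D.hat.X)).left ≫ m = 𝟙 _ := by
    have hu : (lift (toUnit _ ≫ η[D.hat.X]) (𝟙 D.hat.X)).left ≫ (D.hat.X ⊗ D.hat.X).hom = D.hat.X.hom := Over.w _
    have h2 : (lift (toUnit _ ≫ η[D.hat.X]) (𝟙 D.hat.X)).left ≫ (snd D.hat.X D.hat.X).left = 𝟙 _ := by
      rw [← Over.comp_left, lift_snd]; rfl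
    have key := huniq (lift (toUnit _ ≫ η[D.hat.X]) (𝟙 D.hat.X)).left
      ((lift (toUnit _ ≫ η[D.hat.X]) (𝟙 D.hat.X)).left ≫ (snd D.hat.X D.hat.X).left) (by rw [Category.assoc, Over.w]) ?_
    · rw [← key, h2]
    obtain ⟨e₁⟩ := hunit _ ((lift (toUnit _ ≫ η[D.hat.X]) (𝟙 D.hat.X)).left ≫ (fst D.hat.X D.hat.X).left)
      (by rw [Category.assoc, Over.w])
      (by rw [← Over.comp_left, lift_fst, Over.comp_left, Over.toUnit_left, hu])
    exact ⟨(tensorUnitLeftIso _).symm ≪≫ (tensorMapIso e₁ (Iso.refl _)).symm⟩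
  -- (ii) + (iv): `m′` is a homomorphism `Â ×_S Â → Â` of abelian schemes (any-base Noetherian rigidity), hence the
  -- multiplication
  let P2 : AbelianSchemeOver S :=
    { X := D.hat.X ⊗ D.hat.X
      isProper := isProper_tensorObj_hom D.hat
      isSmooth := smooth_tensorObj_hom D.hat
      geometricallyConnected := geometricallyConnected_tensorObj_hom D.hat }
  let M : P2.X ⟶ D.hat.X := Over.homMk m hm
  haveI : IsMonHom M :=
    isMonHom_of_one_comp_of_isLocallyNoetherian_base (A := P2) (B := D.hat) M (Over.OverMorphism.ext hone)
  have hM : M = fst D.hat.X D.hat.X * snd D.hat.X D.hat.X :=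
    eq_fst_mul_snd_of_isMonHom D.hat M (Over.OverMorphism.ext hinl) (Over.OverMorphism.ext hinr)
  have hm' : m = (fst D.hat.X D.hat.X * snd D.hat.X D.hat.X).left := by rw [← hM]; rfl
  rw [← D.pullbackP_congr _ hm' hm]
  exact hiso

/-! ## §2 `(1_A × g₁g₂)^*𝒫 ≅ (1_A × g₁)^*𝒫 ⊗ (1_A × g₂)^*𝒫` for `T`-valued points — any locally Noetherian base -/

/-- **THE GROUP LAW OF `Â` IS THE TENSOR PRODUCT OF FAMILIES over ANY locally Noetherian base** (no reducedness, no connectedness;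
[MumfordAV1970, §8]: `Â → Pic⁰(A)` is a homomorphism, over a base): for a dual pair `D = (Â, 𝒫)` of `A/S` satisfying the unit
hypothesis `𝒫|_{A × {ε_Â}} ≅ 𝒪`, any `S`-scheme `T` and any two `T`-valued points `g₁, g₂ : T ⟶ Â` of `Over S` (multiplied
by the group law of `Â`): `(1_A × g₁g₂)^*𝒫 ≅ (1_A × g₁)^*𝒫 ⊗ (1_A × g₂)^*𝒫` on `A_T` — the pull-back of §1 along
`1_A × (g₁, g₂) : A_T → A_{Â ×_S Â}` (the plumbing of ★ `nonempty_pullbackP_mul_iso_of_isLocallyNoetherian`, verbatim; no hypothesis on `T`).  Stated for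
`T : Over S` (the form in which `gᵢ = uᵢ ≫ λ` arise); for `f : T₀ → S` take `T = Over.mk f`.
[cite: MumfordAV1970, §8 (pp. 74–75) and §13 (p. 125)] [cite: MilneAV2008, I §8 pp. 36–37] -/
private theorem nonempty_pullbackP_mul_iso_aux
    (hD : Nonempty ((Scheme.Modules.pullback (unitHatSlice D)).obj D.P ≅ SheafOfModules.unit _))
    {T : Over S} (g₁ g₂ : T ⟶ D.hat.X) :
    Nonempty (D.pullbackP T.hom (g₁ * g₂).left (Over.w _) ≅
      tensorObj (D.pullbackP T.hom g₁.left (Over.w g₁)) (D.pullbackP T.hom g₂.left (Over.w g₂))) := by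
  obtain ⟨I⟩ := D.nonempty_pullbackP_fst_mul_snd_iso_tensor_of_isLocallyNoetherian_base hD
  -- `1_A × (g₁, g₂) : A_T → A_{Â ×_S Â}`
  have hu : (lift g₁ g₂).left ≫ (D.hat.X ⊗ D.hat.X).hom = T.hom := Over.w _
  obtain ⟨r, hr₁, hr₂⟩ : ∃ r : (A.baseChange T.hom).left ⟶ (A.baseChange (D.hat.X ⊗ D.hat.X).hom).left,
      r ≫ pullback.fst _ _ = pullback.fst _ _ ∧ r ≫ pullback.snd _ _ = pullback.snd _ _ ≫ (lift g₁ g₂).left :=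
    ⟨pullback.lift (pullback.fst _ _) (pullback.snd _ _ ≫ (lift g₁ g₂).left)
      (by rw [pullback.condition, Category.assoc, hu]), pullback.lift_fst _ _ _, pullback.lift_snd _ _ _⟩
  have hr : ∀ (g : (D.hat.X ⊗ D.hat.X).left ⟶ D.hat.X.left) (hg : g ≫ D.hat.X.hom = (D.hat.X ⊗ D.hat.X).hom),
      r ≫ A.baseChangeToProd D.hat _ g hg =
        A.baseChangeToProd D.hat T.hom ((lift g₁ g₂).left ≫ g) (by rw [Category.assoc, hg, hu]) := by
    intro g hg
    apply pullback.hom_ext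
    · rw [Category.assoc, baseChangeToProd_fst, baseChangeToProd_fst, hr₁]
    · rw [Category.assoc, baseChangeToProd_snd, baseChangeToProd_snd, ← Category.assoc, hr₂, Category.assoc]
  -- `(1_A × (g₁,g₂))^* (1_A × g)^* 𝒫 ≅ (1_A × ((g₁,g₂) ≫ g))^* 𝒫`
  have e : ∀ (g : (D.hat.X ⊗ D.hat.X).left ⟶ D.hat.X.left) (hg : g ≫ D.hat.X.hom = (D.hat.X ⊗ D.hat.X).hom),
      (Scheme.Modules.pullback r).obj (D.pullbackP _ g hg) ≅
        D.pullbackP T.hom ((lift g₁ g₂).left ≫ g) (by rw [Category.assoc, hg, hu]) := fun g hg =>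
    (Scheme.Modules.pullbackComp _ _).app D.P ≪≫ (Scheme.Modules.pullbackCongr (hr g hg)).app D.P
  have h12 : (lift g₁ g₂).left ≫ (fst D.hat.X D.hat.X * snd D.hat.X D.hat.X).left = (g₁ * g₂).left := by
    rw [← Over.comp_left, MonObj.comp_mul, lift_fst, lift_snd]
  have h1 : (lift g₁ g₂).left ≫ (fst D.hat.X D.hat.X).left = g₁.left := by rw [← Over.comp_left, lift_fst]
  have h2 : (lift g₁ g₂).left ≫ (snd D.hat.X D.hat.X).left = g₂.left := by rw [← Over.comp_left, lift_snd]
  refine ⟨?_⟩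
  rw [← D.pullbackP_congr T.hom h12 (by rw [Category.assoc, Over.w, hu]) (Over.w _),
    ← D.pullbackP_congr T.hom h1 (by rw [Category.assoc, Over.w, hu]) (Over.w g₁),
    ← D.pullbackP_congr T.hom h2 (by rw [Category.assoc, Over.w, hu]) (Over.w g₂)]
  exact (e _ (Over.w _)).symm ≪≫ (Scheme.Modules.pullback r).mapIso I ≪≫
    pullbackTensorIso r (HasRank.isFiniteLocallyFree' (D.hasRank_one_pullbackP _ _ (Over.w _)))
      (HasRank.isFiniteLocallyFree' (D.hasRank_one_pullbackP _ _ (Over.w _))) ≪≫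
    tensorMapIso (e _ (Over.w _)) (e _ (Over.w _))

/-- The same over a structure morphism `f : T → S` (`T` a scheme, `g₁ g₂ : Over.mk f ⟶ Â`), together with the INVERSE:
`(1_A × g⁻¹)^*𝒫 ⊗ (1_A × g)^*𝒫 ≅ 𝒪` — `Â(T) → Pic(A_T)` is a group homomorphism (unit: `hD`; [MumfordAV1970, §8 (p. 75)]).
[cite: MumfordAV1970, §8 (pp. 74–75) and §13 (p. 125)] [cite: MilneAV2008, I §8 pp. 36–37] -/
private theorem nonempty_pullbackP_inv_tensor_iso_unit_aux
    (hD : Nonempty ((Scheme.Modules.pullback (unitHatSlice D)).obj D.P ≅ SheafOfModules.unit _))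
    {T : Over S} (g : T ⟶ D.hat.X) :
    Nonempty (tensorObj (D.pullbackP T.hom (g⁻¹).left (Over.w _)) (D.pullbackP T.hom g.left (Over.w g)) ≅
      SheafOfModules.unit _) := by
  obtain ⟨I⟩ := D.nonempty_pullbackP_mul_iso_aux hD g⁻¹ g
  -- `g⁻¹ · g = 1 = toUnit ≫ ε`, whose underlying morphism is `T.hom ≫ ε_Â`; and `(1_A × (T.hom ≫ ε_Â))^*𝒫 ≅ 𝒪` by `hD`
  have hε : (g⁻¹ * g).left = T.hom ≫ D.hat.unitSection := by
    rw [inv_mul_cancel, Hom.one_def, Over.comp_left, Over.toUnit_left]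
  have hf : (T.hom ≫ D.hat.unitSection) ≫ D.hat.X.hom = T.hom := by
    rw [Category.assoc, D.hat.unitSection_comp_hom, Category.comp_id]
  obtain ⟨J⟩ := D.nonempty_pullbackP_comp_unitSection_iso T.hom hD hf
  rw [D.pullbackP_congr T.hom hε (Over.w _) hf] at I
  exact ⟨I.symm ≪≫ J⟩

/-! ## §3 Powers: `(1_A × gⁿ)^*𝒫 ≅ ((1_A × g)^*𝒫)^{⊗n}` — any locally Noetherian base -/

/-- **`(1_A × gⁿ)^*𝒫 ≅ ((1_A × g)^*𝒫)^{⊗ n}`** on `A_T`, for ANY locally Noetherian `S`, the unit hypothesis `hD`, an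
`S`-scheme `T` and a `T`-valued point `g : T → Â` (`gⁿ` its power in `Hom_S(T, Â)`): induction on `n` through §2
(`n = 0` is ★ `nonempty_pullbackP_comp_unitSection_iso`); the reduced-base edition is ★ `nonempty_pullbackP_pow_iso_tensorPow`,
the connected-base one ★ `nonempty_pullbackP_pow_iso_tensorPow_of_isLocallyNoetherian`.
[cite: MumfordAV1970, §8 (pp. 74–75) and §13 (p. 125)] [cite: MilneAV2008, I §8 pp. 36–37] -/
private theorem nonempty_pullbackP_pow_iso_tensorPow_aux
    (hD : Nonempty ((Scheme.Modules.pullback (unitHatSlice D)).obj D.P ≅ SheafOfModules.unit _))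
    {T : Over S} (g : T ⟶ D.hat.X) :
    ∀ n : ℕ, Nonempty (D.pullbackP T.hom (g ^ n).left (Over.w _) ≅ tensorPow (D.pullbackP T.hom g.left (Over.w g)) n)
  | 0 => by
    rw [tensorPow_zero]
    have h1 : ((1 : T ⟶ D.hat.X)).left = T.hom ≫ D.hat.unitSection := by
      change (toUnit T ≫ η[D.hat.X]).left = T.hom ≫ D.hat.unitSection
      rw [Over.comp_left, Over.toUnit_left]
    have hf : (T.hom ≫ D.hat.unitSection) ≫ D.hat.X.hom = T.hom := by
      rw [Category.assoc, D.hat.unitSection_comp_hom, Category.comp_id]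
    have hc : D.pullbackP T.hom ((g ^ 0)).left (Over.w _) = D.pullbackP T.hom (T.hom ≫ D.hat.unitSection) hf :=
      D.pullbackP_congr T.hom (by rw [pow_zero, h1]) _ _
    rw [hc]
    exact D.nonempty_pullbackP_comp_unitSection_iso T.hom hD hf
  | n + 1 => by
    obtain ⟨e⟩ := nonempty_pullbackP_pow_iso_tensorPow_aux hD g n
    obtain ⟨m⟩ := D.nonempty_pullbackP_mul_iso_aux hD (g ^ n) g
    have hc : D.pullbackP T.hom ((g ^ (n + 1))).left (Over.w _) = D.pullbackP T.hom ((g ^ n * g)).left (Over.w _) :=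
      D.pullbackP_congr T.hom (by rw [pow_succ]) _ _
    rw [hc, tensorPow_succ]
    exact ⟨m ≪≫ tensorMapIso e (Iso.refl _)⟩

/-! ## §4 Public forms, in the `Over S` spelling `(A ◁ g)^*𝒫` of `(1_A × g)^*𝒫` -/

omit [IsLocallyNoetherian S] in
/-- `(1_A × g)^*𝒫 = (A ◁ g)^*𝒫`: the `DualPair` module `pullbackP` along a `T`-valued point `g : T → Â` of `Over S` is the
pull-back of `𝒫` along the cartesian-monoidal whiskering `A ◁ g : A ⊗ T → A ⊗ Â` (★ `baseChangeToProd_eq_whiskerLeft_left`).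
[cite: MilneAV2008, I §8 pp. 36–37] -/
theorem pullbackP_eq_pullback_whiskerLeft {T : Over S} (g : T ⟶ D.hat.X) :
    D.pullbackP T.hom g.left (Over.w g) = (Scheme.Modules.pullback (A.X ◁ g).left).obj D.P :=
  congrArg (fun k => (Scheme.Modules.pullback k).obj D.P) (A.baseChangeToProd_eq_whiskerLeft_left D.hat g)

/-- **THE GROUP LAW OF `Â` IS THE TENSOR PRODUCT OF FAMILIES — ANY locally Noetherian base** (no reducedness, no
connectedness; [MumfordAV1970, §8]: `Â → Pic⁰(A)` is a homomorphism, over a base): for a dual pair `D = (Â, 𝒫)` of `A/S`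
with the unit hypothesis `𝒫|_{A × {ε_Â}} ≅ 𝒪`, any `T : Over S` and `g₁ g₂ : T ⟶ Â`,
`(A ◁ g₁g₂)^*𝒫 ≅ (A ◁ g₁)^*𝒫 ⊗ (A ◁ g₂)^*𝒫` on `A ×_S T`.  (The REDUCED-base edition is ★ `nonempty_pullbackP_mul_iso`, the
CONNECTED-base edition ★ `nonempty_pullbackP_mul_iso_of_isLocallyNoetherian`, both in the `pullbackP` spelling — convert with
`pullbackP_eq_pullback_whiskerLeft`.) [cite: MumfordAV1970, §8 (pp. 74–75) and §13 (p. 125)] [cite: MilneAV2008, I §8 pp. 36–37]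
[cite: MumfordFogartyKirwan1994, Ch. 6 §1 Corollary 6.4 (p. 117)] -/
theorem nonempty_pullback_whiskerLeft_mul_iso_tensor
    (hD : Nonempty ((Scheme.Modules.pullback (unitHatSlice D)).obj D.P ≅ SheafOfModules.unit _))
    {T : Over S} (g₁ g₂ : T ⟶ D.hat.X) :
    Nonempty ((Scheme.Modules.pullback (A.X ◁ (g₁ * g₂)).left).obj D.P ≅
      tensorObj ((Scheme.Modules.pullback (A.X ◁ g₁).left).obj D.P) ((Scheme.Modules.pullback (A.X ◁ g₂).left).obj D.P)) := by
  rw [← D.pullbackP_eq_pullback_whiskerLeft, ← D.pullbackP_eq_pullback_whiskerLeft, ← D.pullbackP_eq_pullback_whiskerLeft]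
  exact D.nonempty_pullbackP_mul_iso_aux hD g₁ g₂

/-- **`(A ◁ g⁻¹)^*𝒫 ⊗ (A ◁ g)^*𝒫 ≅ 𝒪` — ANY locally Noetherian base** (`Â(T) → Pic(A_T)` is a group homomorphism; unit: `hD`).
[cite: MumfordAV1970, §8 (pp. 74–75) and §13 (p. 125)] [cite: MilneAV2008, I §8 pp. 36–37] -/
theorem nonempty_tensor_pullback_whiskerLeft_inv_iso_unit
    (hD : Nonempty ((Scheme.Modules.pullback (unitHatSlice D)).obj D.P ≅ SheafOfModules.unit _))
    {T : Over S} (g : T ⟶ D.hat.X) :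
    Nonempty (tensorObj ((Scheme.Modules.pullback (A.X ◁ g⁻¹).left).obj D.P)
      ((Scheme.Modules.pullback (A.X ◁ g).left).obj D.P) ≅ SheafOfModules.unit _) := by
  rw [← D.pullbackP_eq_pullback_whiskerLeft, ← D.pullbackP_eq_pullback_whiskerLeft]
  exact D.nonempty_pullbackP_inv_tensor_iso_unit_aux hD g

/-- **`(A ◁ gⁿ)^*𝒫 ≅ ((A ◁ g)^*𝒫)^{⊗n}` — ANY locally Noetherian base** (induction on `n` through the biadditivity; the
REDUCED-base edition is ★ `nonempty_pullbackP_pow_iso_tensorPow`, the CONNECTED-base one ★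
`nonempty_pullbackP_pow_iso_tensorPow_of_isLocallyNoetherian`). [cite: MumfordAV1970, §8 (pp. 74–75) and §13 (p. 125)]
[cite: MilneAV2008, I §8 pp. 36–37] -/
theorem nonempty_pullback_whiskerLeft_pow_iso_tensorPow
    (hD : Nonempty ((Scheme.Modules.pullback (unitHatSlice D)).obj D.P ≅ SheafOfModules.unit _))
    {T : Over S} (g : T ⟶ D.hat.X) (n : ℕ) :
    Nonempty ((Scheme.Modules.pullback (A.X ◁ (g ^ n)).left).obj D.P ≅
      tensorPow ((Scheme.Modules.pullback (A.X ◁ g).left).obj D.P) n) := by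
  rw [← D.pullbackP_eq_pullback_whiskerLeft, ← D.pullbackP_eq_pullback_whiskerLeft]
  exact D.nonempty_pullbackP_pow_iso_tensorPow_aux hD g n

end DualPair



end AbelianSchemeOver

end Literature.AlgebraicGeometry.AbelianSchemes

end
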